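import Literature.Probability.Distributions.IndepProductLawDistance
import Literature.Computability.QuantumComplexity.DyadicThresholds
import Mathlib.Data.List.GetD
import HarnessLib

/-!
# Sequential bit sampling: kernels, the chain-rule law, and the hybrid bound

Topic `Literature/Probability/Distributions`, theorems + three transparent definitions, companion of
`IndepProductLawDistance.lean` (`PMF.tvDist_bind_bind_le`: priors and kernels together,
`Δ(μ ≫= f, ν ≫= g) ≤ Δ(μ, ν) + δ`). A distribution on bit strings of length `n` is sampled BIT BY
BIT: after the prefix `p`, append `1` with probability `κ p` — this is how a classical machine with
coins samples an explicitly computable distribution ("it first takes a sample `z` by measuring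
`|v_{T+1}⟩` in the computational basis", Aaronson–Chen 2017, proof of Lemma 5.3, p. 23: the machine
compares its coins with the CONDITIONAL Born probabilities, one bit at a time), and the only error
is the rounding of each conditional to the coin grid. This file provides:

* `coin t` — the Bernoulli law of parameter `t ∈ [0,1]` (clamped), `coin_apply_true/false`,
  `tvDist_coin` (`Δ(coin s, coin t) = |s − t|`);
* `seqPMF κ n` — the law of `n` bits drawn sequentially with the kernel `κ : List Bool → ℝ`,
  `seqPMF_append_singleton` (the chain rule `Pr[p b] = Pr[p] · coin(κ p)(b)`),
  `seqPMF_eq_zero_of_length_ne`, `toReal_seqPMF_eq_prod` (closed form as a product of factors `seqFactor`);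
* **`tvDist_seqPMF_le`** — the hybrid bound: kernels within `δ` pointwise give laws within `n·δ`;
* `prefixWeight μ p` (the mass of the strings extending `p` under a law `μ` on strings of length
  `n`), the conditional kernel `condKernel μ` (`W(p1)/W(p)`, and `0` on a null prefix) and
  **`seqPMF_condKernel`**: `seqPMF (condKernel μ) n = μ` for every law `μ` supported on strings of
  length `n` — the chain rule;
* `roundKernel μ m` — the coin-grid rounding `#{j < 2^m : j·W(p) < 2^m·W(p1)}/2^m` in the form a
  machine decides it (one comparison per coin block), `abs_roundKernel_sub_condKernel_le`
  (`≤ 2^{-m}`), whence **`tvDist_seqPMF_roundKernel_le`**: sampling with the rounded conditionals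
  is within `n/2^m` of `μ`.

## References

* O. Goldreich, *Foundations of Cryptography I*, CUP 2001, §3.2.2 (hybrid arguments), as in
  `IndepProductLawDistance.lean` [Goldreich2001].
* S. Aaronson, L. Chen, CCC 2017 (arXiv:1612.05903), proof of Lemma 5.3 (p. 23) [AaronsonChen2017].
* D. E. Knuth, A. C. Yao, *The complexity of nonuniform random number generation* (1976), §2 (bit-by-bit
  generation of a distribution from fair coins) [folklore].
-/

noncomputable section

open scoped ENNReal
open PMF

namespace Literature.Probability.Distributions

/-! ### Coins -/

/-- The clamp of a real to `[0, 1]`. [folklore] -/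
def clamp01 (t : ℝ) : ℝ := max 0 (min t 1)

/-- `0 ≤ clamp01 t ≤ 1`. [folklore] -/
theorem clamp01_mem (t : ℝ) : 0 ≤ clamp01 t ∧ clamp01 t ≤ 1 :=
  ⟨le_max_left _ _, max_le zero_le_one (min_le_right _ _)⟩

/-- The clamp is the identity on `[0, 1]`. [folklore] -/
theorem clamp01_of_mem {t : ℝ} (h0 : 0 ≤ t) (h1 : t ≤ 1) : clamp01 t = t := by
  rw [clamp01, min_eq_left h1, max_eq_right h0]

/-- **The coin of parameter `t`**: `true` with probability `clamp01 t`. [folklore] -/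
def coin (t : ℝ) : PMF Bool :=
  PMF.ofFintype (fun b => if b then ENNReal.ofReal (clamp01 t) else ENNReal.ofReal (1 - clamp01 t)) (by
    rw [Fintype.sum_bool, if_pos rfl, if_neg Bool.false_ne_true,
      ← ENNReal.ofReal_add (clamp01_mem t).1 (by linarith [(clamp01_mem t).2]), add_sub_cancel, ENNReal.ofReal_one])

/-- The coin shows `true` with probability `clamp01 t`. [folklore] -/
theorem coin_apply_true (t : ℝ) : coin t true = ENNReal.ofReal (clamp01 t) := by
  rw [coin, PMF.ofFintype_apply, if_pos rfl]

/-- The coin shows `false` with probability `1 − clamp01 t`. [folklore] -/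
theorem coin_apply_false (t : ℝ) : coin t false = ENNReal.ofReal (1 - clamp01 t) := by
  rw [coin, PMF.ofFintype_apply, if_neg Bool.false_ne_true]

/-- Real values of the coin. [folklore] -/
theorem toReal_coin_apply (t : ℝ) (b : Bool) :
    (coin t b).toReal = if b then clamp01 t else 1 - clamp01 t := by
  cases b
  · rw [coin_apply_false, ENNReal.toReal_ofReal (by linarith [(clamp01_mem t).2])]; rfl
  · rw [coin_apply_true, ENNReal.toReal_ofReal (clamp01_mem t).1]; rfl

/-- **Statistical distance of two coins**: `Δ(coin s, coin t) = |clamp01 s − clamp01 t|`. [cite: Goldreich2001, §3.2.1] -/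
theorem tvDist_coin (s t : ℝ) : (coin s).tvDist (coin t) = |clamp01 s - clamp01 t| := by
  rw [PMF.tvDist, tsum_fintype, Fintype.sum_bool, toReal_coin_apply, toReal_coin_apply, toReal_coin_apply,
    toReal_coin_apply]
  simp only [if_true, Bool.false_eq_true, if_false]
  rw [show (1 - clamp01 s - (1 - clamp01 t)) = -(clamp01 s - clamp01 t) by ring, abs_neg]
  ring

/-! ### Sequential sampling with a kernel -/

/-- **The law of `n` bits drawn one after the other**, the bit after the prefix `p` being `1` with
probability `κ p`. [cite: AaronsonChen2017, §5.3 (p. 23)] -/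
def seqPMF (κ : List Bool → ℝ) : ℕ → PMF (List Bool)
  | 0 => PMF.pure []
  | n + 1 => (seqPMF κ n).bind fun p => (coin (κ p)).map fun b => p ++ [b]

/-- The empty string for `n = 0`. [folklore] -/
@[simp] theorem seqPMF_zero (κ : List Bool → ℝ) : seqPMF κ 0 = PMF.pure [] := rfl

/-- The recursion. [folklore] -/
theorem seqPMF_succ (κ : List Bool → ℝ) (n : ℕ) :
    seqPMF κ (n + 1) = (seqPMF κ n).bind fun p => (coin (κ p)).map fun b => p ++ [b] := rfl

/-- The law is supported on strings of length `n`. [folklore] -/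
theorem seqPMF_eq_zero_of_length_ne (κ : List Bool → ℝ) : ∀ (n : ℕ) (z : List Bool), z.length ≠ n → seqPMF κ n z = 0
  | 0, z, hz => by
    rw [seqPMF_zero, PMF.pure_apply, if_neg]
    rintro rfl; exact hz rfl
  | n + 1, z, hz => by
    rw [seqPMF_succ, PMF.bind_apply]
    refine ENNReal.tsum_eq_zero.2 fun p => ?_
    by_cases hp : p.length = n
    · rw [PMF.map_apply]
      refine mul_eq_zero_of_right _ (ENNReal.tsum_eq_zero.2 fun b => ?_)
      rw [if_neg]
      rintro rfl
      exact hz (by simp [hp])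
    · rw [seqPMF_eq_zero_of_length_ne κ n p hp, zero_mul]

/-- **The chain rule**: `Pr[p b] = Pr[p] · coin(κ p)(b)`. [folklore] -/
theorem seqPMF_append_singleton (κ : List Bool → ℝ) (n : ℕ) (p : List Bool) (b : Bool) :
    seqPMF κ (n + 1) (p ++ [b]) = seqPMF κ n p * coin (κ p) b := by
  rw [seqPMF_succ, PMF.bind_apply]
  rw [tsum_eq_single p]
  · rw [PMF.map_apply, tsum_eq_single b]
    · rw [if_pos rfl]
    · intro b' hb'
      rw [if_neg]
      intro h
      exact hb' (List.append_cancel_left h |> List.singleton_inj.1).symm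
  · intro p' hp'
    rw [PMF.map_apply]
    refine mul_eq_zero_of_right _ (ENNReal.tsum_eq_zero.2 fun b' => ?_)
    rw [if_neg]
    intro h
    exact hp' (List.append_inj_left' h rfl).symm

/-- The factor contributed by the `i`-th bit of `z`. [folklore] -/
def seqFactor (κ : List Bool → ℝ) (z : List Bool) (i : ℕ) : ℝ :=
  if z.getD i false then clamp01 (κ (z.take i)) else 1 - clamp01 (κ (z.take i))

/-- Factors are in `[0, 1]`. [folklore] -/
theorem seqFactor_mem (κ : List Bool → ℝ) (z : List Bool) (i : ℕ) : 0 ≤ seqFactor κ z i ∧ seqFactor κ z i ≤ 1 := by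
  unfold seqFactor
  have := clamp01_mem (κ (z.take i))
  split_ifs <;> constructor <;> linarith

/-- **Closed form**: on a string of length `n` the law is the product of its factors. [folklore] -/
theorem toReal_seqPMF_eq_prod (κ : List Bool → ℝ) : ∀ (n : ℕ) (z : List Bool), z.length = n →
    (seqPMF κ n z).toReal = ∏ i ∈ Finset.range n, seqFactor κ z i
  | 0, z, hz => by
    rw [List.length_eq_zero_iff] at hz
    subst hz
    simp
  | n + 1, z, hz => by
    obtain ⟨p, b, rfl⟩ : ∃ p b, z = p ++ [b] := by
      have hne : z ≠ [] := by rintro rfl; simp at hz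
      exact ⟨z.dropLast, z.getLast hne, (List.dropLast_append_getLast hne).symm⟩
    have hp : p.length = n := by simpa using hz
    rw [seqPMF_append_singleton, ENNReal.toReal_mul, toReal_seqPMF_eq_prod κ n p hp, Finset.prod_range_succ,
      toReal_coin_apply]
    congr 1
    · refine Finset.prod_congr rfl fun i hi => ?_
      rw [Finset.mem_range] at hi
      unfold seqFactor
      rw [List.getD_append _ _ _ _ (by omega), List.take_append_of_le_length (by omega)]
    · unfold seqFactor
      have ht : List.take n (p ++ [b]) = p := by
        rw [List.take_append_of_le_length hp.ge, List.take_of_length_le hp.le]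
      rw [List.getD_append_right _ _ _ _ (by omega), hp, Nat.sub_self, List.getD_cons_zero, ht]

/-! ### The hybrid bound -/

/-- **Kernels within `δ` give laws within `n·δ`.** [cite: Goldreich2001, §3.2.2 (hybrid argument)] -/
theorem tvDist_seqPMF_le (κ κ' : List Bool → ℝ) {δ : ℝ}
    (h : ∀ p : List Bool, |clamp01 (κ p) - clamp01 (κ' p)| ≤ δ) :
    ∀ n : ℕ, (seqPMF κ n).tvDist (seqPMF κ' n) ≤ n * δ
  | 0 => by simp [PMF.tvDist_self]
  | n + 1 => by
    rw [seqPMF_succ, seqPMF_succ, Nat.cast_succ, add_mul, one_mul]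
    have ih := tvDist_seqPMF_le κ κ' h n
    have hker : ∀ p : List Bool,
        (((coin (κ p)).map fun b => p ++ [b]).tvDist ((coin (κ' p)).map fun b => p ++ [b])) ≤ δ := fun p =>
      (PMF.tvDist_map_le_holds _ _ _).trans (by rw [tvDist_coin]; exact h p)
    exact (PMF.tvDist_bind_bind_le _ _ _ _ hker).trans (by linarith)

/-! ### The conditional kernel of a law and the chain rule -/

section Conditional

variable (μ : PMF (List Bool)) (n : ℕ)

/-- **The prefix weight** `W(p) = Pr_μ[the sample extends p]`. [folklore] -/
def prefixWeight (p : List Bool) : ℝ := (∑' z : List Bool, if p <+: z then μ z else 0).toReal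

/-- The prefix sum is finite. [folklore] -/
theorem prefixSum_ne_top (p : List Bool) : (∑' z : List Bool, if p <+: z then μ z else 0) ≠ ⊤ := by
  refine ne_top_of_le_ne_top (PMF.tsum_coe μ ▸ ENNReal.one_ne_top) (ENNReal.tsum_le_tsum fun z => ?_)
  split_ifs
  · exact le_rfl
  · exact bot_le

/-- Prefix weights are nonnegative. [folklore] -/
theorem prefixWeight_nonneg (p : List Bool) : 0 ≤ prefixWeight μ p := ENNReal.toReal_nonneg

/-- Extending the prefix lowers the weight. [folklore] -/
theorem prefixWeight_append_le (p q : List Bool) : prefixWeight μ (p ++ q) ≤ prefixWeight μ p := by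
  unfold prefixWeight
  refine ENNReal.toReal_mono (prefixSum_ne_top μ p) (ENNReal.tsum_le_tsum fun z => ?_)
  by_cases h : p ++ q <+: z
  · rw [if_pos h, if_pos ((List.prefix_append p q).trans h)]
  · rw [if_neg h]; exact bot_le

/-- The empty prefix has weight `1`. [folklore] -/
theorem prefixWeight_nil : prefixWeight μ [] = 1 := by
  unfold prefixWeight
  simp [PMF.tsum_coe]

/-- **Splitting a prefix over the next bit** (laws supported on strings of one length `n > |p|`).
[folklore] -/
theorem prefixWeight_eq_add (hn : ∀ z ∈ μ.support, z.length = n) (p : List Bool) (hp : p.length < n) :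
    prefixWeight μ p = prefixWeight μ (p ++ [false]) + prefixWeight μ (p ++ [true]) := by
  unfold prefixWeight
  rw [← ENNReal.toReal_add (prefixSum_ne_top μ _) (prefixSum_ne_top μ _), ← ENNReal.tsum_add]
  congr 1
  refine tsum_congr fun z => ?_
  by_cases hz : z ∈ μ.support
  · have hlen := hn z hz
    by_cases h : p <+: z
    · obtain ⟨t, rfl⟩ := h
      rcases t with _ | ⟨b, t⟩
      · simp at hlen; omega
      · have e : p ++ b :: t = (p ++ [b]) ++ t := by simp
        have hne : ∀ b' : Bool, b' ≠ b → ¬ (p ++ [b'] <+: p ++ b :: t) := by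
          rintro b' hb' ⟨t', h'⟩
          rw [List.append_assoc, List.singleton_append] at h'
          have h2 := List.append_cancel_left h'
          simp only [List.cons.injEq] at h2
          exact hb' h2.1
        cases b
        · rw [if_pos ⟨_, rfl⟩, if_pos ⟨t, e.symm⟩, if_neg (hne true (by decide)), add_zero]
        · rw [if_pos ⟨_, rfl⟩, if_neg (hne false (by decide)), if_pos ⟨t, e.symm⟩, zero_add]
    · rw [if_neg h, if_neg (fun h' => h ((List.prefix_append _ _).trans h')),
        if_neg (fun h' => h ((List.prefix_append _ _).trans h')), add_zero]
  · rw [PMF.mem_support_iff, not_not] at hz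
    simp [hz]

/-- On a string of full length the prefix weight is its probability. [folklore] -/
theorem prefixWeight_eq_toReal (hn : ∀ z ∈ μ.support, z.length = n) (z : List Bool) (hz : z.length = n) :
    prefixWeight μ z = (μ z).toReal := by
  unfold prefixWeight
  congr 1
  rw [tsum_eq_single z]
  · rw [if_pos (List.prefix_refl z)]
  · intro z' hz'
    by_cases hs : z' ∈ μ.support
    · rw [if_neg]
      rintro ⟨t, rfl⟩
      have hl := hn _ hs
      rw [List.length_append, hz] at hl
      have ht : t = [] := List.length_eq_zero_iff.1 (by omega)
      exact hz' (by rw [ht, List.append_nil])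
    · rw [PMF.mem_support_iff, not_not] at hs
      simp [hs]

/-- **The conditional kernel** of `μ`: `Pr[next bit = 1 | prefix p] = W(p1)/W(p)`, and `0` on a null
prefix. [cite: AaronsonChen2017, §5.3 (p. 23, the conditional measurement probabilities)] -/
def condKernel (p : List Bool) : ℝ :=
  if prefixWeight μ p = 0 then 0 else prefixWeight μ (p ++ [true]) / prefixWeight μ p

/-- The conditional kernel is a probability. [folklore] -/
theorem condKernel_mem (p : List Bool) : 0 ≤ condKernel μ p ∧ condKernel μ p ≤ 1 := by
  unfold condKernel
  split_ifs with h
  · exact ⟨le_rfl, zero_le_one⟩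
  · have h0 := prefixWeight_nonneg μ p
    have h1 := prefixWeight_append_le μ p [true]
    have h2 := prefixWeight_nonneg μ (p ++ [true])
    exact ⟨div_nonneg h2 h0, (div_le_one (lt_of_le_of_ne h0 (Ne.symm h))).2 h1⟩

/-- **The factor of the conditional kernel is the ratio of prefix weights** (times the current
weight): `W(p) · factor(b) = W(p b)`. [folklore] -/
theorem prefixWeight_mul_seqFactor (hn : ∀ z ∈ μ.support, z.length = n) (z : List Bool) (i : ℕ) (hi : i < z.length)
    (hin : i < n) :
    prefixWeight μ (z.take i) * seqFactor (condKernel μ) z i = prefixWeight μ (z.take (i + 1)) := by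
  have htake : z.take (i + 1) = z.take i ++ [z.getD i false] := by
    rw [List.getD_eq_getElem?_getD, List.getElem?_eq_getElem hi, Option.getD_some, List.take_succ_eq_append_getElem hi]
  have hsplit := prefixWeight_eq_add μ n hn (z.take i) (by rw [List.length_take]; omega)
  unfold seqFactor
  rw [clamp01_of_mem (condKernel_mem μ _).1 (condKernel_mem μ _).2, htake]
  unfold condKernel
  by_cases h0 : prefixWeight μ (z.take i) = 0
  · -- a null prefix has null extensions
    have h1 : prefixWeight μ (z.take i ++ [z.getD i false]) = 0 :=
      le_antisymm (h0 ▸ prefixWeight_append_le μ _ _) (prefixWeight_nonneg μ _)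
    rw [h0, h1, zero_mul]
  · rw [if_neg h0]
    cases z.getD i false
    · simp only [Bool.false_eq_true, if_false]
      field_simp
      linarith
    · simp only [if_true]
      field_simp

/-- The product of the first `i` factors is the weight of the `i`-prefix. [folklore] -/
theorem prefixWeight_take_eq_prod (hn : ∀ z ∈ μ.support, z.length = n) (z : List Bool) (hz : z.length = n) :
    ∀ i ≤ n, ∏ j ∈ Finset.range i, seqFactor (condKernel μ) z j = prefixWeight μ (z.take i)
  | 0, _ => by simp [prefixWeight_nil]
  | i + 1, hi => by
    rw [Finset.prod_range_succ, prefixWeight_take_eq_prod hn z hz i (Nat.le_of_succ_le hi),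
      prefixWeight_mul_seqFactor μ n hn z i (by omega) hi]

/-- **The chain rule**: sampling bit by bit with the conditional kernel of `μ` reproduces `μ`
(for `μ` supported on the strings of length `n`). [cite: AaronsonChen2017, §5.3 (p. 23)] -/
theorem seqPMF_condKernel (hn : ∀ z ∈ μ.support, z.length = n) : seqPMF (condKernel μ) n = μ := by
  ext z
  by_cases hz : z.length = n
  · have h := toReal_seqPMF_eq_prod (condKernel μ) n z hz
    rw [prefixWeight_take_eq_prod μ n hn z hz n le_rfl, List.take_of_length_le hz.le,
      prefixWeight_eq_toReal μ n hn z hz] at h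
    exact (ENNReal.toReal_eq_toReal_iff' (PMF.apply_ne_top _ _) (PMF.apply_ne_top _ _)).1 h
  · rw [seqPMF_eq_zero_of_length_ne _ n z hz]
    symm
    by_contra h
    exact hz (hn z ((PMF.mem_support_iff _ _).2 h))

/-! ### The coin-grid rounding of the conditional kernel -/

/-- **The rounded kernel a machine with `m` coins per bit realises**: the bit is `1` iff the coin
block, read as `j < 2^m`, satisfies the INTEGER-style comparison `j·W(p) < 2^m·W(p1)` (the machine
decides it exactly); as a probability, `#{j < 2^m | j·W(p) < 2^m·W(p1)} / 2^m`.
[cite: AaronsonChen2017, §5.3 (p. 23)] -/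
def roundKernel (m : ℕ) (p : List Bool) : ℝ :=
  (((Finset.range (2 ^ m)).filter fun j : ℕ => (j : ℝ) * prefixWeight μ p < 2 ^ m * prefixWeight μ (p ++ [true])).card : ℝ) /
    2 ^ m

/-- The rounded kernel is a probability. [folklore] -/
theorem roundKernel_mem (m : ℕ) (p : List Bool) : 0 ≤ roundKernel μ m p ∧ roundKernel μ m p ≤ 1 := by
  unfold roundKernel
  refine ⟨by positivity, (div_le_one (by positivity)).2 ?_⟩
  have h := Finset.card_filter_le (Finset.range (2 ^ m))
    (fun j : ℕ => (j : ℝ) * prefixWeight μ p < 2 ^ m * prefixWeight μ (p ++ [true]))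
  rw [Finset.card_range] at h
  exact_mod_cast h

/-- **Rounding error**: `|roundKernel − condKernel| ≤ 2^{-m}`. [folklore] -/
theorem abs_roundKernel_sub_condKernel_le (m : ℕ) (p : List Bool) :
    |roundKernel μ m p - condKernel μ p| ≤ 1 / 2 ^ m := by
  have h2m : (0 : ℝ) < 2 ^ m := by positivity
  unfold roundKernel condKernel
  by_cases h0 : prefixWeight μ p = 0
  · have h1 : prefixWeight μ (p ++ [true]) = 0 :=
      le_antisymm (h0 ▸ prefixWeight_append_le μ _ _) (prefixWeight_nonneg μ _)
    rw [if_pos h0, h0, h1]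
    simp
  · rw [if_neg h0]
    have hW : 0 < prefixWeight μ p := lt_of_le_of_ne (prefixWeight_nonneg μ p) (Ne.symm h0)
    set τ := prefixWeight μ (p ++ [true]) / prefixWeight μ p with hτ
    have hτ0 : 0 ≤ τ := div_nonneg (prefixWeight_nonneg μ _) hW.le
    have hτ1 : τ ≤ 1 := (div_le_one hW).2 (prefixWeight_append_le μ p [true])
    have hfilter : ((Finset.range (2 ^ m)).filter fun j : ℕ => (j : ℝ) * prefixWeight μ p < 2 ^ m * prefixWeight μ (p ++ [true])) =
        (Finset.range (2 ^ m)).filter fun j : ℕ => (j : ℝ) < 2 ^ m * τ := by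
      refine Finset.filter_congr fun j _ => ?_
      rw [hτ, ← mul_div_assoc, lt_div_iff₀ hW]
    rw [hfilter]
    have hc := Literature.Computability.QuantumComplexity.card_filter_lt_real m hτ0 hτ1
    rw [show ((((Finset.range (2 ^ m)).filter fun j : ℕ => (j : ℝ) < 2 ^ m * τ).card : ℝ) / 2 ^ m - τ) =
        ((((Finset.range (2 ^ m)).filter fun j : ℕ => (j : ℝ) < 2 ^ m * τ).card : ℝ) - 2 ^ m * τ) / 2 ^ m by
      field_simp, abs_div, abs_of_pos h2m]
    exact div_le_div_of_nonneg_right hc h2m.le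

/-- **Sampling with the rounded conditionals is within `n/2^m` of the law.**
[cite: AaronsonChen2017, §5.3 (p. 23)] [cite: Goldreich2001, §3.2.2] -/
theorem tvDist_seqPMF_roundKernel_le (hn : ∀ z ∈ μ.support, z.length = n) (m : ℕ) :
    (seqPMF (roundKernel μ m) n).tvDist μ ≤ n * (1 / 2 ^ m) := by
  have h := tvDist_seqPMF_le (roundKernel μ m) (condKernel μ) (δ := 1 / 2 ^ m) (fun p => by
    rw [clamp01_of_mem (roundKernel_mem μ m p).1 (roundKernel_mem μ m p).2,
      clamp01_of_mem (condKernel_mem μ p).1 (condKernel_mem μ p).2]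
    exact abs_roundKernel_sub_condKernel_le μ m p) n
  rwa [seqPMF_condKernel μ n hn] at h

end Conditional

end Literature.Probability.Distributions

end
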